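import Literature.NumberTheory.Irrationality.FischlerSprangZudilin2019.Lemma3Profile
import Literature.NumberTheory.Irrationality.FischlerSprangZudilin2019.TheoremTwo
import Literature.NumberTheory.Transcendental.OddZetaAsymptotics
import Mathlib.Analysis.SpecialFunctions.Pow.Real
import HarnessLib

/-!
# Fischler–Sprang–Zudilin 2019, §4 Lemma 3 — part 3: `r_{n,j} = ∑_k c_{k,j}`, the tail, and
# `lim r_{n,j}^{1/n} = g(x₀)`

Topic `Literature/NumberTheory/Irrationality/FischlerSprangZudilin2019`, namespace
`Literature.NumberTheory.Irrationality.FischlerSprangZudilin2019.Lemma3`. Source: S. Fischler, J. Sprang,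
W. Zudilin, *Many odd zeta values are irrational*, Compositio Math. **155** (2019) 938–952 = arXiv:1803.08905
[FischlerSprangZudilin2019], §4 proof of Lemma 3 (held: `paper:arxiv-1803.08905`, arXiv text pp. 7–8, read on
the page). Third of four files PROVING the tree's named fact `lemma3` (`Asymptotics.lean`); everything here is
proved, no named facts.

## The source, verbatim (the steps formalised here)
"… so that `r_{n,j} = ∑_{m=1}^{∞} R_n(m + j/D) = ∑_{k=0}^{∞} c_{k,j}` is a sum of positive terms." … "At last,
choosing `ε` small we can assume that `A(ε)` is sufficiently large (in terms of `D` and `s`), so that for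
`k ≥ (A(ε)-ε)n` we have `c_{k,j} ≤ (2D)^{3Dn} (n!/k^{n+1})^{s+1-3D}` for `n` large. Using hypothesis (4.1) and the
Stirling formula, the latter estimate implies
`∑_{k ≥ ⌈(A(ε)-ε)n⌉} c_{k,j} ≤ (3D)^{3Dn} n!^{s+1-3D}/((A(ε)-ε)n)^{(s+1-3D)(n+1)-1} ≤ … ≤ (½ g(x₀))^n` (4.7)
provided `n` is sufficiently large. … This implies
`(g(x₀) - 2h(ε))^n ≤ … ≤ r_{n,j} ≤ … ≤ (g(x₀) + 2h(ε))^n` for `n` sufficiently large, and finishes the proof of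
`lim_{n→∞} r_{n,j}^{1/n} = g(x₀)` for any `j`."

## What is proved here
* (the terms `R_n(m + j/D)`, `1 ≤ m < n`, vanish: the tree's `R_shift_eq_zero`, `TheoremTwo.lean`), `cR_le_tail` (the printed far-tail bound in
  the form `c_{k,j} ≤ 2(2D)^{3Dn} A^{-(s+1-3D)n} k^{-2}` for `k ≥ An`, `A ≥ 5`, using `n! ≤ n^n`),
  `summable_cR`, **`r_eq_tsum_cR : r_{n,j} = ∑_k c_{k,j}`** (every `n ≥ 1`; no parity needed), `r_pos'`.
* `exists_body_bound` (the uniform estimate of `Lemma3LogSums.lean` on `k ≤ An`: `|log c_{k,j} - nL(k/n)| ≤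
  B(1 + log(n+1))`), `tsum_tail_le` (`∑_{k > An} c_{k,j} ≤ 2 (2D)^{3Dn}/A^{(s+1-3D)n}`), `exists_A` (a choice
  of `A` making this `≤ 2 (g(x₀)/2)^n`, the printed (4.7)).
* **`tendsto_log_r_div`**: `log r_{n,j} / n → L(x₀) = log g(x₀)` (upper bound from `L ≤ L(x₀)` termwise and the
  tail; lower bound from the single term `k₀(n) = ⌊x₀ n⌋` and continuity of `L`), and
  **`tendsto_r_rpow`**: `r_{n,j}^{1/n} → g(x₀)` — the first limit of (4.2).

## Not here
The ratio `r_{n,j'}/r_{n,j} → 1` and the assembly of `lemma3`: `Lemma3Ratio.lean`. (Theorem 2 itself is already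
proved in the tree by a cruder route, `TheoremTwo.lean`, imported here only for `R_shift_eq_zero`.) Cell zeta5-irr
(rung F-Z1): nothing here bears on `ζ(5)`.
-/

noncomputable section

open Finset Filter Set

open scoped Nat Topology

namespace Literature.NumberTheory.Irrationality.FischlerSprangZudilin2019

namespace Lemma3

/-! ### `r_{n,j} = ∑_k c_{k,j}` -/

/-- **Far-tail bound** (`k ≥ An`, `A ≥ 5`): `c_{k,j} ≤ 2 (2D)^{3Dn} / (A^{(s+1-3D)n} k²)` — from the printed
`c_{k,j} ≤ (2D)^{3Dn}(n!/k^{n+1})^{s+1-3D}`-type estimate and `n! ≤ nⁿ`.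
[cite: FischlerSprangZudilin2019, §4 proof of Lemma 3, eq. (4.7)] -/
theorem cR_le_tail {s D n j A k : ℕ} (hD : 1 ≤ D) (h3D : 3 * D ≤ s) (hn : 1 ≤ n) (hj : 1 ≤ j) (hjD : j ≤ D)
    (hA : 5 ≤ A) (hk : A * n ≤ k) :
    cR s D n j k ≤ 2 * (2 * (D : ℝ)) ^ (3 * D * n) / ((A : ℝ) ^ ((s + 1 - 3 * D) * n) * (k : ℝ) ^ 2) := by
  obtain ⟨a, rfl⟩ := Nat.exists_eq_add_of_le h3D
  have ha : 3 * D + a + 1 - 3 * D = a + 1 := by omega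
  rw [ha]
  have hD' : (1 : ℝ) ≤ D := by exact_mod_cast hD
  have hn' : (1 : ℝ) ≤ n := by exact_mod_cast hn
  have hA' : (5 : ℝ) ≤ A := by exact_mod_cast hA
  have hk' : (A : ℝ) * n ≤ k := by exact_mod_cast hk
  have hjD' : (j : ℝ) ≤ D := by exact_mod_cast hjD
  have hk1 : (1 : ℝ) ≤ k := by nlinarith
  have hk0 : (0 : ℝ) < k := by linarith
  have hkn : 3 * (n : ℝ) + 1 ≤ k := by nlinarith
  -- numerator and denominator
  have hnum : ∏ ℓ ∈ range (3 * D * n + 1), ((k : ℝ) + ((j : ℝ) + ℓ) / D) ≤ (2 * (k : ℝ)) ^ (3 * D * n + 1) := by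
    calc ∏ ℓ ∈ range (3 * D * n + 1), ((k : ℝ) + ((j : ℝ) + ℓ) / D)
        ≤ ∏ _ℓ ∈ range (3 * D * n + 1), (2 * (k : ℝ)) :=
          prod_le_prod (fun ℓ _ => (num_factor_pos hj hjD k ℓ).le) fun ℓ hℓ => by
            have hℓ' : (ℓ : ℝ) ≤ 3 * D * n := by exact_mod_cast (by linarith [mem_range.1 hℓ] : ℓ ≤ 3 * D * n)
            have : ((j : ℝ) + ℓ) / D ≤ k := by
              rw [div_le_iff₀ (by linarith)]
              nlinarith
            linarith
      _ = (2 * (k : ℝ)) ^ (3 * D * n + 1) := by rw [prod_const, card_range]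
  have hden : (k : ℝ) ^ (n + 1) ≤ ∏ ℓ ∈ range (n + 1), ((n : ℝ) + k + (j : ℝ) / D + ℓ) := by
    calc (k : ℝ) ^ (n + 1) = ∏ _ℓ ∈ range (n + 1), (k : ℝ) := by rw [prod_const, card_range]
      _ ≤ ∏ ℓ ∈ range (n + 1), ((n : ℝ) + k + (j : ℝ) / D + ℓ) :=
          prod_le_prod (fun _ _ => hk0.le) fun ℓ _ => by
            have : (0 : ℝ) ≤ (j : ℝ) / D := by positivity
            have : (0 : ℝ) ≤ ℓ := by positivity
            linarith
  have hden' : ((k : ℝ) ^ (n + 1)) ^ (3 * D + a + 1) ≤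
      (∏ ℓ ∈ range (n + 1), ((n : ℝ) + k + (j : ℝ) / D + ℓ)) ^ (3 * D + a + 1) :=
    pow_le_pow_left₀ (by positivity) hden _
  -- n!^{a+1} ≤ (n^n)^{a+1} and (An)^{(a+1)n} ≤ k^{(a+1)n}
  have hfact : ((n ! : ℕ) : ℝ) ≤ (n : ℝ) ^ n := by exact_mod_cast Nat.factorial_le_pow n
  have b1 : ((n ! : ℕ) : ℝ) ^ (a + 1) / (k : ℝ) ^ ((a + 1) * n) ≤ 1 / (A : ℝ) ^ ((a + 1) * n) := by
    rw [div_le_div_iff₀ (by positivity) (by positivity), one_mul]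
    calc ((n ! : ℕ) : ℝ) ^ (a + 1) * (A : ℝ) ^ ((a + 1) * n)
        ≤ ((n : ℝ) ^ n) ^ (a + 1) * (A : ℝ) ^ ((a + 1) * n) :=
          mul_le_mul_of_nonneg_right (pow_le_pow_left₀ (by positivity) hfact _) (by positivity)
      _ = ((A : ℝ) * n) ^ ((a + 1) * n) := by rw [← pow_mul, mul_pow, mul_comm n (a + 1)]; ring
      _ ≤ (k : ℝ) ^ ((a + 1) * n) := pow_le_pow_left₀ (by positivity) hk' _
  have b2 : 1 / (k : ℝ) ^ (3 * D + a) ≤ 1 / (k : ℝ) ^ 2 :=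
    one_div_le_one_div_of_le (by positivity) (pow_le_pow_right₀ hk1 (by omega))
  -- assemble
  have hexp : (n + 1) * (3 * D + a + 1) = (3 * D * n + 1) + ((a + 1) * n + (3 * D + a)) := by ring
  have step : cR (3 * D + a) D n j k ≤ (D : ℝ) ^ (3 * D * n) * ((n ! : ℕ) : ℝ) ^ (a + 1) *
      (2 * (k : ℝ)) ^ (3 * D * n + 1) / ((k : ℝ) ^ (n + 1)) ^ (3 * D + a + 1) := by
    unfold cR
    rw [ha]
    calc (D : ℝ) ^ (3 * D * n) * ((n ! : ℕ) : ℝ) ^ (a + 1) *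
          (∏ ℓ ∈ range (3 * D * n + 1), ((k : ℝ) + ((j : ℝ) + ℓ) / D)) /
          (∏ ℓ ∈ range (n + 1), ((n : ℝ) + k + (j : ℝ) / D + ℓ)) ^ (3 * D + a + 1)
        ≤ (D : ℝ) ^ (3 * D * n) * ((n ! : ℕ) : ℝ) ^ (a + 1) * (2 * (k : ℝ)) ^ (3 * D * n + 1) /
          (∏ ℓ ∈ range (n + 1), ((n : ℝ) + k + (j : ℝ) / D + ℓ)) ^ (3 * D + a + 1) :=
          div_le_div_of_nonneg_right (mul_le_mul_of_nonneg_left hnum (by positivity)) (by positivity)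
      _ ≤ _ := div_le_div_of_nonneg_left (by positivity) (by positivity) hden'
  have eform : (D : ℝ) ^ (3 * D * n) * ((n ! : ℕ) : ℝ) ^ (a + 1) * (2 * (k : ℝ)) ^ (3 * D * n + 1) /
      ((k : ℝ) ^ (n + 1)) ^ (3 * D + a + 1) =
      2 * (2 * (D : ℝ)) ^ (3 * D * n) * (((n ! : ℕ) : ℝ) ^ (a + 1) / (k : ℝ) ^ ((a + 1) * n)) *
        (1 / (k : ℝ) ^ (3 * D + a)) := by
    rw [← pow_mul, hexp]
    field_simp
    ring
  rw [eform] at step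
  calc cR (3 * D + a) D n j k ≤ _ := step
    _ ≤ 2 * (2 * (D : ℝ)) ^ (3 * D * n) * (1 / (A : ℝ) ^ ((a + 1) * n)) * (1 / (k : ℝ) ^ 2) :=
        mul_le_mul (mul_le_mul_of_nonneg_left b1 (by positivity)) b2 (by positivity) (by positivity)
    _ = 2 * (2 * (D : ℝ)) ^ (3 * D * n) / ((A : ℝ) ^ ((a + 1) * n) * (k : ℝ) ^ 2) := by
        field_simp

/-- **Summability of `∑_k c_{k,j}`** (`n ≥ 1`, `1 ≤ j ≤ D`). [cite: FischlerSprangZudilin2019, §4 proof of Lemma 3 ("r_{n,j} = ∑_{k ≥ 0} c_{k,j}")] -/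
theorem summable_cR {s D n j : ℕ} (hD : 1 ≤ D) (h3D : 3 * D ≤ s) (hn : 1 ≤ n) (hj : 1 ≤ j) (hjD : j ≤ D) :
    Summable (fun k => cR s D n j k) := by
  set Cst : ℝ := 2 * (2 * (D : ℝ)) ^ (3 * D * n) / (5 : ℝ) ^ ((s + 1 - 3 * D) * n) with hCst
  have hx : (0 : ℝ) < 5 * n - 1 := by
    have : (1 : ℝ) ≤ n := by exact_mod_cast hn
    linarith
  obtain ⟨hsum, -⟩ := Literature.NumberTheory.Transcendental.OddZeta.tsum_one_div_add_pow_le hx (le_refl 2)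
  have h2 : Summable fun q : ℕ => cR s D n j (q + 5 * n) := by
    refine Summable.of_nonneg_of_le (fun q => (cR_pos hn hj hjD _).le) (fun q => ?_) (hsum.mul_left Cst)
    have h := cR_le_tail (A := 5) (k := q + 5 * n) hD h3D hn hj hjD le_rfl (by omega)
    calc cR s D n j (q + 5 * n) ≤ _ := h
      _ = Cst * (1 / ((q : ℝ) + 1 + (5 * n - 1)) ^ 2) := by
          rw [hCst]
          push_cast
          rw [show (q : ℝ) + 1 + (5 * n - 1) = q + 5 * n by ring]
          field_simp
  exact (summable_nat_add_iff (5 * n)).1 h2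

/-- **`r_{n,j} = ∑_{k ≥ 0} c_{k,j}`** for every `n ≥ 1`, `1 ≤ j ≤ D`.
[cite: FischlerSprangZudilin2019, §4 proof of Lemma 3 ("r_{n,j} = ∑_{m ≥ 1} R_n(m+j/D) = ∑_{k ≥ 0} c_{k,j}")] -/
theorem r_eq_tsum_cR {s D n j : ℕ} (hD : 1 ≤ D) (h3D : 3 * D ≤ s) (hn : 1 ≤ n) (hj : 1 ≤ j) (hjD : j ≤ D) :
    r s D n j = ∑' k, cR s D n j k := by
  have hsum := summable_cR hD h3D hn hj hjD
  set f : ℕ → ℝ := fun m => ((R s D n ((m : ℚ) + 1 + (j : ℚ) / D) : ℚ) : ℝ) with hf_def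
  have hf : ∀ q, f (q + (n - 1)) = cR s D n j q := fun q => by
    rw [hf_def, show q + (n - 1) = n - 1 + q from Nat.add_comm _ _]
    exact R_cast_eq_cR hn j q
  have hfun : (fun q => f (q + (n - 1))) = fun q => cR s D n j q := funext hf
  have hfs : Summable f := (summable_nat_add_iff (n - 1)).1 (by rw [hfun]; exact hsum)
  have hzero : ∑ m ∈ range (n - 1), f m = 0 := by
    refine sum_eq_zero fun m hm => ?_
    rw [hf_def]
    have h0 := R_shift_eq_zero (s := s) (n := n) hj hjD (by have := mem_range.1 hm; omega : m + 2 ≤ n)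
    show ((R s D n ((m : ℚ) + 1 + (j : ℚ) / D) : ℚ) : ℝ) = 0
    rw [h0, Rat.cast_zero]
  rw [r, ← hfs.sum_add_tsum_nat_add (n - 1), hzero, zero_add, hfun]

/-- **`r_{n,j} > 0`** for every `n ≥ 1`, `1 ≤ j ≤ D` (no parity condition).
[cite: FischlerSprangZudilin2019, §4 proof of Lemma 3 ("a sum of positive terms")] -/
theorem r_pos' {s D n j : ℕ} (hD : 1 ≤ D) (h3D : 3 * D ≤ s) (hn : 1 ≤ n) (hj : 1 ≤ j) (hjD : j ≤ D) :
    0 < r s D n j := by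
  rw [r_eq_tsum_cR hD h3D hn hj hjD]
  exact (summable_cR hD h3D hn hj hjD).tsum_pos (fun k => (cR_pos hn hj hjD k).le) 0 (cR_pos hn hj hjD 0)

/-! ### The body `k ≤ An`: uniform two-sided bounds -/

/-- **Uniform estimate on `k ≤ An`**: `|log c_{k,j} - n L(k/n)| ≤ B (1 + log(n+1))`.
[cite: FischlerSprangZudilin2019, §4 proof of Lemma 3 ("it follows from the proof of Eq. (4.4) that g(x₀)-h(ε) ≤ c_{k,j}^{1/n} ≤ g(x₀)+h(ε)")] -/
theorem exists_body_bound {s D : ℕ} (hD : 1 ≤ D) (h3D : 3 * D ≤ s) (A : ℕ) :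
    ∃ B : ℝ, 0 < B ∧ ∀ n k j : ℕ, 1 ≤ n → 1 ≤ j → j ≤ D → k ≤ A * n →
      |Real.log (cR s D n j k) - n * Lprof s D ((k : ℝ) / n)| ≤ B * (1 + Real.log ((n : ℝ) + 1)) := by
  obtain ⟨C, hC, h⟩ := log_cR_sub_profile hD h3D
  have hA0 : (0 : ℝ) ≤ A := by positivity
  have hlA : 0 ≤ Real.log ((A : ℝ) + 1) := Real.log_nonneg (by linarith)
  refine ⟨C * (2 + Real.log ((A : ℝ) + 1)), by positivity, fun n k j hn hj hjD hk => ?_⟩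
  have hk' : (k : ℝ) ≤ A * n := by exact_mod_cast hk
  have hn' : (1 : ℝ) ≤ n := by exact_mod_cast hn
  have hlog : Real.log ((k : ℝ) + 1) ≤ Real.log ((A : ℝ) + 1) + Real.log ((n : ℝ) + 1) := by
    rw [← Real.log_mul (by linarith) (by linarith)]
    exact Real.log_le_log (by positivity) (by nlinarith)
  have hln : 0 ≤ Real.log ((n : ℝ) + 1) := Real.log_nonneg (by linarith)
  calc |Real.log (cR s D n j k) - n * Lprof s D ((k : ℝ) / n)|
      ≤ C * (1 + Real.log ((n : ℝ) + 1) + Real.log ((k : ℝ) + 1)) := h n k j hn hj hjD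
    _ ≤ C * (1 + Real.log ((n : ℝ) + 1) + (Real.log ((A : ℝ) + 1) + Real.log ((n : ℝ) + 1))) := by
        gcongr
    _ ≤ C * (2 + Real.log ((A : ℝ) + 1)) * (1 + Real.log ((n : ℝ) + 1)) := by
        have := mul_nonneg hlA hln
        nlinarith

/-- From the body estimate: `c_{k,j} ≤ exp(n L(k/n) + B(1 + log(n+1)))` and
`exp(n L(k/n) - B(1 + log(n+1))) ≤ c_{k,j}`. [cite: FischlerSprangZudilin2019, §4 proof of Lemma 3 (eq. (4.4) on the window)] -/
theorem cR_exp_bounds {s D n j k : ℕ} {B : ℝ} (hn : 1 ≤ n) (hj : 1 ≤ j) (hjD : j ≤ D)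
    (h : |Real.log (cR s D n j k) - n * Lprof s D ((k : ℝ) / n)| ≤ B * (1 + Real.log ((n : ℝ) + 1))) :
    cR s D n j k ≤ Real.exp (n * Lprof s D ((k : ℝ) / n) + B * (1 + Real.log ((n : ℝ) + 1))) ∧
      Real.exp (n * Lprof s D ((k : ℝ) / n) - B * (1 + Real.log ((n : ℝ) + 1))) ≤ cR s D n j k := by
  have hc := cR_pos (s := s) hn hj hjD k
  rw [abs_le] at h
  constructor
  · calc cR s D n j k = Real.exp (Real.log (cR s D n j k)) := (Real.exp_log hc).symm
      _ ≤ _ := Real.exp_le_exp.2 (by linarith [h.2])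
  · calc Real.exp (n * Lprof s D ((k : ℝ) / n) - B * (1 + Real.log ((n : ℝ) + 1)))
        ≤ Real.exp (Real.log (cR s D n j k)) := Real.exp_le_exp.2 (by linarith [h.1])
      _ = cR s D n j k := Real.exp_log hc

/-! ### The tail `k > An` -/

/-- **Tail bound**: `∑_{k ≥ An+1} c_{k,j} ≤ 2 (2D)^{3Dn} / A^{(s+1-3D)n}` (`A ≥ 5`), together with the
summability of the shifted family. [cite: FischlerSprangZudilin2019, §4 proof of Lemma 3, eq. (4.7)] -/
theorem tsum_tail_le {s D n j A : ℕ} (hD : 1 ≤ D) (h3D : 3 * D ≤ s) (hn : 1 ≤ n) (hj : 1 ≤ j) (hjD : j ≤ D)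
    (hA : 5 ≤ A) :
    Summable (fun q : ℕ => cR s D n j (q + (A * n + 1))) ∧
      ∑' q : ℕ, cR s D n j (q + (A * n + 1)) ≤ 2 * (2 * (D : ℝ)) ^ (3 * D * n) / (A : ℝ) ^ ((s + 1 - 3 * D) * n) := by
  set M : ℝ := 2 * (2 * (D : ℝ)) ^ (3 * D * n) / (A : ℝ) ^ ((s + 1 - 3 * D) * n) with hM
  have hAn : (1 : ℝ) ≤ (A : ℝ) * n := by
    have : (5 : ℝ) ≤ A := by exact_mod_cast hA
    have : (1 : ℝ) ≤ n := by exact_mod_cast hn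
    nlinarith
  have hx : (0 : ℝ) < (A : ℝ) * n := by linarith
  obtain ⟨hsum, hle⟩ := Literature.NumberTheory.Transcendental.OddZeta.tsum_one_div_add_pow_le hx (le_refl 2)
  have hA0 : (0 : ℝ) < A := by exact_mod_cast (lt_of_lt_of_le (by norm_num) hA)
  have hterm : ∀ q : ℕ, cR s D n j (q + (A * n + 1)) ≤ M * (1 / ((q : ℝ) + 1 + (A : ℝ) * n) ^ 2) := by
    intro q
    have h := cR_le_tail (k := q + (A * n + 1)) hD h3D hn hj hjD hA (by omega)
    calc cR s D n j (q + (A * n + 1)) ≤ _ := h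
      _ = M * (1 / ((q : ℝ) + 1 + (A : ℝ) * n) ^ 2) := by
          rw [hM]
          push_cast
          rw [show (q : ℝ) + ((A : ℝ) * n + 1) = q + 1 + A * n by ring]
          field_simp
  have hS : Summable (fun q : ℕ => cR s D n j (q + (A * n + 1))) :=
    Summable.of_nonneg_of_le (fun q => (cR_pos hn hj hjD _).le) hterm (hsum.mul_left M)
  refine ⟨hS, ?_⟩
  have hM0 : 0 ≤ M := by rw [hM]; positivity
  calc ∑' q : ℕ, cR s D n j (q + (A * n + 1))
      ≤ ∑' q : ℕ, M * (1 / ((q : ℝ) + 1 + (A : ℝ) * n) ^ 2) := hS.tsum_le_tsum hterm (hsum.mul_left M)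
    _ = M * ∑' q : ℕ, 1 / ((q : ℝ) + 1 + (A : ℝ) * n) ^ 2 := tsum_mul_left
    _ ≤ M * 1 := by
        refine mul_le_mul_of_nonneg_left (hle.trans ?_) hM0
        rw [div_le_one (by positivity)]
        nlinarith
    _ = M := mul_one M

/-- **The decomposition** `r_{n,j} = ∑_{k ≤ An} c_{k,j} + ∑_{k > An} c_{k,j}`.
[cite: FischlerSprangZudilin2019, §4 proof of Lemma 3, eq. (4.8)] -/
theorem r_eq_sum_add_tail {s D n j : ℕ} (hD : 1 ≤ D) (h3D : 3 * D ≤ s) (hn : 1 ≤ n) (hj : 1 ≤ j)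
    (hjD : j ≤ D) (K : ℕ) :
    r s D n j = ∑ k ∈ range K, cR s D n j k + ∑' q : ℕ, cR s D n j (q + K) := by
  rw [r_eq_tsum_cR hD h3D hn hj hjD, ← (summable_cR hD h3D hn hj hjD).sum_add_tsum_nat_add K]

/-- **Choice of the cut-off `A`** (the source's `A(ε)` "sufficiently large in terms of `D` and `s`"): `A ≥ 5`,
`A ≥ x₀ + 1` and `(2D)^{3D}/A^{s+1-3D} ≤ g(x₀)/2`. [cite: FischlerSprangZudilin2019, §4 proof of Lemma 3 ("choosing ε small we can assume that A(ε) is sufficiently large")] -/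
theorem exists_A {s D : ℕ} (hD : 1 ≤ D) (h3D : 3 * D ≤ s) {x₀ : ℝ} (hx₀ : 0 < x₀) :
    ∃ A : ℕ, 5 ≤ A ∧ x₀ + 1 ≤ A ∧
      (2 * (D : ℝ)) ^ (3 * D) / (A : ℝ) ^ (s + 1 - 3 * D) ≤ gRate s D x₀ / 2 := by
  have hg := gRate_pos (s := s) hD hx₀.le
  obtain ⟨A, hA⟩ := exists_nat_ge (max 5 (max (x₀ + 1) (2 * (2 * (D : ℝ)) ^ (3 * D) / gRate s D x₀)))
  have h5 : (5 : ℝ) ≤ A := le_trans (le_max_left _ _) hA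
  have hx : x₀ + 1 ≤ A := le_trans ((le_max_left _ _).trans (le_max_right _ _)) hA
  have hAg : 2 * (2 * (D : ℝ)) ^ (3 * D) / gRate s D x₀ ≤ A :=
    le_trans ((le_max_right _ _).trans (le_max_right _ _)) hA
  refine ⟨A, by exact_mod_cast h5, hx, ?_⟩
  have hA1 : (1 : ℝ) ≤ A := by linarith
  have hpow : (A : ℝ) ≤ (A : ℝ) ^ (s + 1 - 3 * D) := le_self_pow₀ hA1 (by omega)
  calc (2 * (D : ℝ)) ^ (3 * D) / (A : ℝ) ^ (s + 1 - 3 * D) ≤ (2 * (D : ℝ)) ^ (3 * D) / A :=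
        div_le_div_of_nonneg_left (by positivity) (by linarith) hpow
    _ ≤ gRate s D x₀ / 2 := by
        rw [div_le_iff₀ (by linarith)]
        rw [div_le_iff₀ hg] at hAg
        linarith

/-- With such an `A`: `∑_{k > An} c_{k,j} ≤ 2 (g(x₀)/2)^n` (the printed (4.7)).
[cite: FischlerSprangZudilin2019, §4 proof of Lemma 3, eq. (4.7)] -/
theorem tsum_tail_le_geom {s D n j A : ℕ} (hD : 1 ≤ D) (h3D : 3 * D ≤ s) (hn : 1 ≤ n) (hj : 1 ≤ j) (hjD : j ≤ D)
    (hA : 5 ≤ A) {x₀ : ℝ} (hAg : (2 * (D : ℝ)) ^ (3 * D) / (A : ℝ) ^ (s + 1 - 3 * D) ≤ gRate s D x₀ / 2) :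
    ∑' q : ℕ, cR s D n j (q + (A * n + 1)) ≤ 2 * (gRate s D x₀ / 2) ^ n := by
  have h := (tsum_tail_le hD h3D hn hj hjD hA).2
  have hA0 : (0 : ℝ) < A := by exact_mod_cast (lt_of_lt_of_le (by norm_num) hA)
  have e : 2 * (2 * (D : ℝ)) ^ (3 * D * n) / (A : ℝ) ^ ((s + 1 - 3 * D) * n) =
      2 * ((2 * (D : ℝ)) ^ (3 * D) / (A : ℝ) ^ (s + 1 - 3 * D)) ^ n := by
    rw [div_pow, ← pow_mul, ← pow_mul]
    ring
  rw [e] at h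
  exact h.trans (mul_le_mul_of_nonneg_left (pow_le_pow_left₀ (by positivity) hAg n) (by norm_num))

/-! ### The limit `r_{n,j}^{1/n} → g(x₀)` -/

/-- `(1 + log(n+1))/n → 0`. [cite: FischlerSprangZudilin2019, §4 proof of Lemma 3 (the polynomial factors "5εn", "7εn/(1-3ε)" are negligible)] -/
theorem tendsto_one_add_log_div : Tendsto (fun n : ℕ => (1 + Real.log ((n : ℝ) + 1)) / n) atTop (𝓝 0) := by
  have h1 : Tendsto (fun n : ℕ => Real.log (n : ℝ) / (n : ℝ)) atTop (𝓝 0) :=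
    Real.isLittleO_log_id_atTop.tendsto_div_nhds_zero.comp tendsto_natCast_atTop_atTop
  have h2 : Tendsto (fun n : ℕ => (1 + Real.log 2) / (n : ℝ)) atTop (𝓝 0) :=
    tendsto_const_div_atTop_nhds_zero_nat _
  have h3 : Tendsto (fun n : ℕ => (1 + Real.log 2) / (n : ℝ) + Real.log (n : ℝ) / (n : ℝ)) atTop (𝓝 0) := by
    simpa using h2.add h1
  refine tendsto_of_tendsto_of_tendsto_of_le_of_le' tendsto_const_nhds h3 ?_ ?_
  · filter_upwards [eventually_ge_atTop 1] with n hn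
    have : (1 : ℝ) ≤ n := by exact_mod_cast hn
    have : 0 ≤ Real.log ((n : ℝ) + 1) := Real.log_nonneg (by linarith)
    positivity
  · filter_upwards [eventually_ge_atTop 1] with n hn
    have hn' : (1 : ℝ) ≤ n := by exact_mod_cast hn
    have hlog : Real.log ((n : ℝ) + 1) ≤ Real.log 2 + Real.log n := by
      rw [← Real.log_mul (by norm_num) (by linarith)]
      exact Real.log_le_log (by linarith) (by linarith)
    rw [← add_div, div_le_div_iff_of_pos_right (by linarith)]
    linarith

/-- `⌊x₀ n⌋/n → x₀` along the naturals. [cite: FischlerSprangZudilin2019, §4 proof of Lemma 3 ("denoting by k₀(n) the integer part of x₀n")] -/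
theorem tendsto_floor_div {x₀ : ℝ} (hx₀ : 0 ≤ x₀) :
    Tendsto (fun n : ℕ => (⌊x₀ * n⌋₊ : ℝ) / n) atTop (𝓝 x₀) :=
  (tendsto_nat_floor_mul_div_atTop hx₀).comp tendsto_natCast_atTop_atTop

/-- `⌊x₀ n⌋ ≤ An` when `x₀ + 1 ≤ A`. [cite: FischlerSprangZudilin2019, §4 proof of Lemma 3 (k₀(n) = ⌊x₀n⌋)] -/
theorem floor_le_mul {x₀ : ℝ} (hx₀ : 0 ≤ x₀) {A : ℕ} (hA : x₀ + 1 ≤ A) (n : ℕ) : ⌊x₀ * n⌋₊ ≤ A * n := by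
  have h1 : (⌊x₀ * n⌋₊ : ℝ) ≤ x₀ * n := Nat.floor_le (by positivity)
  have h2 : x₀ * n ≤ (A : ℝ) * n := mul_le_mul_of_nonneg_right (by linarith) (by positivity)
  exact_mod_cast h1.trans h2

/-- **Upper bound for `r_{n,j}`**: `r_{n,j} ≤ g(x₀)^n exp(K(1 + log(n+1)))` for all `n ≥ 1`, `1 ≤ j ≤ D`.
[cite: FischlerSprangZudilin2019, §4 proof of Lemma 3 ("r_{n,j} ≤ (7εn/(1-3ε))(g(x₀)+h(ε))^n ≤ (g(x₀)+2h(ε))^n")] -/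
theorem r_le_exp {s D : ℕ} (hD : 1 ≤ D) (h3D : 3 * D ≤ s) {x₀ : ℝ} (hx₀ : 0 < x₀) (hf1 : fRatio s D x₀ = 1)
    (hlt : ∀ x, 0 < x → x < x₀ → 1 < fRatio s D x) (hgt : ∀ x, x₀ < x → fRatio s D x < 1) :
    ∃ K : ℝ, 0 < K ∧ ∀ n j : ℕ, 1 ≤ n → 1 ≤ j → j ≤ D →
      r s D n j ≤ gRate s D x₀ ^ n * Real.exp (K * (1 + Real.log ((n : ℝ) + 1))) := by
  obtain ⟨A, hA5, hAx, hAg⟩ := exists_A (s := s) hD h3D hx₀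
  obtain ⟨B, hB, hbody⟩ := exists_body_bound (s := s) hD h3D A
  have hg := gRate_pos (s := s) hD hx₀.le
  have hLr := Lprof_root hD hx₀ hf1
  have hA0 : (0 : ℝ) ≤ A := by positivity
  have hlA : 0 ≤ Real.log ((A : ℝ) + 1) := Real.log_nonneg (by linarith)
  refine ⟨B + Real.log ((A : ℝ) + 1) + 2, by positivity, fun n j hn hj hjD => ?_⟩
  have hn' : (1 : ℝ) ≤ n := by exact_mod_cast hn
  set ln := Real.log ((n : ℝ) + 1) with hln
  have hln0 : 0 ≤ ln := Real.log_nonneg (by linarith)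
  set g₀ := gRate s D x₀ with hg₀
  -- the body terms
  have hterm : ∀ k ∈ range (A * n + 1), cR s D n j k ≤ g₀ ^ n * Real.exp (B * (1 + ln)) := by
    intro k hk
    have hk' : k ≤ A * n := by have := mem_range.1 hk; omega
    have h1 := (cR_exp_bounds hn hj hjD (hbody n k j hn hj hjD hk')).1
    have h2 : (n : ℝ) * Lprof s D ((k : ℝ) / n) ≤ n * Real.log g₀ := by
      rw [hg₀, ← hLr]
      exact mul_le_mul_of_nonneg_left (Lprof_le_root hD hx₀ hlt hgt (by positivity)) (by positivity)
    calc cR s D n j k ≤ Real.exp (n * Lprof s D ((k : ℝ) / n) + B * (1 + ln)) := h1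
      _ ≤ Real.exp (n * Real.log g₀ + B * (1 + ln)) := Real.exp_le_exp.2 (by linarith)
      _ = g₀ ^ n * Real.exp (B * (1 + ln)) := by rw [Real.exp_add, Real.exp_nat_mul, Real.exp_log hg]
  have hbodysum : ∑ k ∈ range (A * n + 1), cR s D n j k ≤
      ((A * n + 1 : ℕ) : ℝ) * (g₀ ^ n * Real.exp (B * (1 + ln))) := by
    have := Finset.sum_le_card_nsmul _ _ _ hterm
    rwa [card_range, nsmul_eq_mul] at this
  -- the tail
  have htail : ∑' q : ℕ, cR s D n j (q + (A * n + 1)) ≤ 2 * g₀ ^ n := by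
    refine (tsum_tail_le_geom (n := n) hD h3D hn hj hjD hA5 hAg).trans ?_
    have : (g₀ / 2) ^ n ≤ g₀ ^ n := pow_le_pow_left₀ (by positivity) (by linarith) n
    linarith
  rw [r_eq_sum_add_tail hD h3D hn hj hjD (A * n + 1)]
  -- (An+1) e^{B(1+ln)} + 2 ≤ e^{K(1+ln)}
  set y := Real.log ((A : ℝ) + 1) + ln + B * (1 + ln) with hy
  have hy0 : 0 ≤ y := by rw [hy]; positivity
  have hAn1 : ((A * n + 1 : ℕ) : ℝ) ≤ Real.exp (Real.log ((A : ℝ) + 1) + ln) := by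
    rw [Real.exp_add, Real.exp_log (by linarith), hln, Real.exp_log (by linarith)]
    push_cast
    nlinarith
  have hX : ((A * n + 1 : ℕ) : ℝ) * Real.exp (B * (1 + ln)) ≤ Real.exp y := by
    rw [hy, Real.exp_add (Real.log ((A : ℝ) + 1) + ln)]
    exact mul_le_mul_of_nonneg_right hAn1 (by positivity)
  have he2 : (3 : ℝ) ≤ Real.exp 2 := by have := Real.add_one_le_exp (2 : ℝ); linarith
  have hX2 : Real.exp y + 2 ≤ Real.exp (y + 2) := by
    rw [Real.exp_add y 2]
    have h1 : (1 : ℝ) ≤ Real.exp y := Real.one_le_exp hy0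
    nlinarith [mul_le_mul_of_nonneg_left he2 (Real.exp_pos y).le, h1]
  have hK : y + 2 ≤ (B + Real.log ((A : ℝ) + 1) + 2) * (1 + ln) := by
    rw [hy]
    have := mul_nonneg hlA hln0
    nlinarith
  calc ∑ k ∈ range (A * n + 1), cR s D n j k + ∑' q : ℕ, cR s D n j (q + (A * n + 1))
      ≤ ((A * n + 1 : ℕ) : ℝ) * (g₀ ^ n * Real.exp (B * (1 + ln))) + 2 * g₀ ^ n := add_le_add hbodysum htail
    _ = g₀ ^ n * (((A * n + 1 : ℕ) : ℝ) * Real.exp (B * (1 + ln)) + 2) := by ring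
    _ ≤ g₀ ^ n * Real.exp (y + 2) := mul_le_mul_of_nonneg_left (by linarith) (by positivity)
    _ ≤ g₀ ^ n * Real.exp ((B + Real.log ((A : ℝ) + 1) + 2) * (1 + ln)) :=
        mul_le_mul_of_nonneg_left (Real.exp_le_exp.2 hK) (by positivity)

/-- **Lower bound for `r_{n,j}`** from the single term `k₀(n) = ⌊x₀ n⌋`:
`exp(n L(k₀/n) - B(1 + log(n+1))) ≤ r_{n,j}`. [cite: FischlerSprangZudilin2019, §4 proof of Lemma 3, eq. (4.4) ("(g(x₀)-2h(ε))^n ≤ … ≤ r_{n,j}")] -/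
theorem exp_le_r {s D : ℕ} (hD : 1 ≤ D) (h3D : 3 * D ≤ s) {x₀ : ℝ} (hx₀ : 0 < x₀) :
    ∃ B : ℝ, 0 < B ∧ ∀ n j : ℕ, 1 ≤ n → 1 ≤ j → j ≤ D →
      Real.exp (n * Lprof s D ((⌊x₀ * n⌋₊ : ℝ) / n) - B * (1 + Real.log ((n : ℝ) + 1))) ≤ r s D n j := by
  obtain ⟨A, -, hAx, -⟩ := exists_A (s := s) hD h3D hx₀
  obtain ⟨B, hB, hbody⟩ := exists_body_bound (s := s) hD h3D A
  refine ⟨B, hB, fun n j hn hj hjD => ?_⟩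
  have hk := floor_le_mul hx₀.le hAx n
  have h := (cR_exp_bounds hn hj hjD (hbody n _ j hn hj hjD hk)).2
  refine h.trans ?_
  rw [r_eq_tsum_cR hD h3D hn hj hjD]
  exact (summable_cR hD h3D hn hj hjD).le_tsum _ (fun k _ => (cR_pos hn hj hjD k).le)

/-- **`log r_{n,j} / n → log g(x₀)`**. [cite: FischlerSprangZudilin2019, §4 Lemma 3 eq. (4.2) (first limit, logarithmic form)] -/
theorem tendsto_log_r_div {s D j : ℕ} (hD : 1 ≤ D) (h3D : 3 * D ≤ s) {x₀ : ℝ} (hx₀ : 0 < x₀)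
    (hf1 : fRatio s D x₀ = 1) (hlt : ∀ x, 0 < x → x < x₀ → 1 < fRatio s D x)
    (hgt : ∀ x, x₀ < x → fRatio s D x < 1) (hj : 1 ≤ j) (hjD : j ≤ D) :
    Tendsto (fun n : ℕ => Real.log (r s D n j) / n) atTop (𝓝 (Real.log (gRate s D x₀))) := by
  obtain ⟨K, -, hup⟩ := r_le_exp hD h3D hx₀ hf1 hlt hgt
  obtain ⟨B, -, hlow⟩ := exp_le_r (s := s) hD h3D hx₀
  have hg := gRate_pos (s := s) hD hx₀.le
  set ℓ₀ := Real.log (gRate s D x₀) with hℓ₀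
  have hu := tendsto_one_add_log_div
  have hU : Tendsto (fun n : ℕ => ℓ₀ + K * ((1 + Real.log ((n : ℝ) + 1)) / n)) atTop (𝓝 ℓ₀) := by
    simpa using tendsto_const_nhds.add (hu.const_mul K)
  have hLcont : Tendsto (fun n : ℕ => Lprof s D ((⌊x₀ * n⌋₊ : ℝ) / n)) atTop (𝓝 ℓ₀) := by
    have := ((continuous_Lprof s D).tendsto x₀).comp (tendsto_floor_div hx₀.le)
    rwa [Lprof_root hD hx₀ hf1] at this
  have hL : Tendsto (fun n : ℕ => Lprof s D ((⌊x₀ * n⌋₊ : ℝ) / n) - B * ((1 + Real.log ((n : ℝ) + 1)) / n))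
      atTop (𝓝 ℓ₀) := by
    simpa using hLcont.sub (hu.const_mul B)
  refine tendsto_of_tendsto_of_tendsto_of_le_of_le' hL hU ?_ ?_
  · filter_upwards [eventually_ge_atTop 1] with n hn
    have hn' : (0 : ℝ) < n := by exact_mod_cast hn
    have h := Real.log_le_log (Real.exp_pos _) (hlow n j hn hj hjD)
    rw [Real.log_exp] at h
    rw [le_div_iff₀ hn']
    have e : (Lprof s D ((⌊x₀ * n⌋₊ : ℝ) / n) - B * ((1 + Real.log ((n : ℝ) + 1)) / n)) * n =
        n * Lprof s D ((⌊x₀ * n⌋₊ : ℝ) / n) - B * (1 + Real.log ((n : ℝ) + 1)) := by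
      field_simp
    rw [e]
    exact h
  · filter_upwards [eventually_ge_atTop 1] with n hn
    have hn' : (0 : ℝ) < n := by exact_mod_cast hn
    have hr := r_pos' hD h3D hn hj hjD
    have h := Real.log_le_log hr (hup n j hn hj hjD)
    rw [Real.log_mul (by positivity) (by positivity), Real.log_pow, Real.log_exp] at h
    rw [div_le_iff₀ hn']
    have e : (ℓ₀ + K * ((1 + Real.log ((n : ℝ) + 1)) / n)) * n = n * ℓ₀ + K * (1 + Real.log ((n : ℝ) + 1)) := by
      field_simp
    rw [e]
    exact h

/-- **`r_{n,j}^{1/n} → g(x₀)`** — the first limit of (4.2), for every `1 ≤ j ≤ D` (`D ≥ 1`, `s ≥ 3D`).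
[cite: FischlerSprangZudilin2019, §4 Lemma 3 eq. (4.2) ("lim r_{n,j}^{1/n} = g(x₀)")] -/
theorem tendsto_r_rpow {s D j : ℕ} (hD : 1 ≤ D) (h3D : 3 * D ≤ s) {x₀ : ℝ} (hx₀ : 0 < x₀)
    (hf1 : fRatio s D x₀ = 1) (hlt : ∀ x, 0 < x → x < x₀ → 1 < fRatio s D x)
    (hgt : ∀ x, x₀ < x → fRatio s D x < 1) (hj : 1 ≤ j) (hjD : j ≤ D) :
    Tendsto (fun n : ℕ => (r s D n j) ^ ((1 : ℝ) / n)) atTop (𝓝 (gRate s D x₀)) := by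
  have h := tendsto_log_r_div hD h3D hx₀ hf1 hlt hgt hj hjD
  have hg := gRate_pos (s := s) hD hx₀.le
  have h2 := (Real.continuous_exp.tendsto _).comp h
  rw [Real.exp_log hg] at h2
  refine h2.congr' ?_
  filter_upwards [eventually_ge_atTop 1] with n hn
  have hr := r_pos' hD h3D hn hj hjD
  simp only [Function.comp_apply]
  rw [Real.rpow_def_of_pos hr, div_eq_mul_one_div]

end Lemma3

end Literature.NumberTheory.Irrationality.FischlerSprangZudilin2019
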